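import Summits.ValiantsHypothesis.ValiantsHypothesis.Theorems.MonotoneRestorationOrbitRestorationQPKeyedBlocks
import Summits.ValiantsHypothesis.ValiantsHypothesis.Theorems.MonotoneRestorationOrbitRestorationQPSignCount
import HarnessLib

/-!
# Keyed blocks in PARITY form (ORBIT currency, ΠΣ sub-rung)

Route MonotoneRestoration, crux `OrbitRestorationQP` (stmt-ValiantsHypothesis-18293), line `depth-three-rung`,
stub A₁ `stub_piSigmaValue`, namespace `Summit.ValiantsHypothesis.ValiantsHypothesis.Theorems.KeyedParity`.

The keyed-block theorem `KeyedBlocks.qpOrbitRestorable_of_keyedBlocks` asks, for its two hypotheses (MID) and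
(TOP), that certain transpositions FIX certain sub-block / superblock products.  By unique factorisation a
transposition `τ` fixing the labels permutes the block's factor multiset up to units, so by the sign count
(`SignCount.ren_prod_eq_self_iff_even`) "`τ` fixes the block" is the same as "the number of block factors
NEGATED by `τ` (`τ · ℓ = -ℓ`, counted with multiplicity) is even".  This file records the keyed-block
theorem with (MID) and (TOP) in that COUNTING form — the form in which the crux workfile
`Cruxes/OrbitRestorationQP/PISIGMA-SUBRUNG.md` (rule M2′ and its parity lemma) verifies them:

* `filter_map_ren_eq_map_filter` / `map_mk_map_ren_filter_eq` — for an equivariant unit-invariant label `lab`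
  and `σ • b = b`, the fibre `{ℓ ∈ L : lab ℓ = b}` and its `σ`-translate have the same associates;
* `ren_fibre_prod_eq_self_iff_even` — an involution `τ` with `τ • b = b` fixes the fibre product iff it
  negates an even number of fibre members;
* **`qpOrbitRestorable_of_keyedBlocks_parity`** — supports + keys (`key ⊆ supp`, unit-invariant,
  equivariant) with
  (MID#) for all `K, T` and `x, y ∈ T ∖ K`: `#{ℓ ∈ L : key ℓ = K, supp ℓ = T, (x y)·ℓ = -ℓ}` is even, and
  (TOP#) for all `K` and `x, y ∈ K`: `#{ℓ ∈ L : key ℓ = K, (x y)·ℓ = -ℓ}` is even,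
  give `QPOrbitRestorable (k + 5)`.

Everything is proved. [folklore]

## References
* A. Dawar, G. Wilsenach, *Symmetric arithmetic circuits*, ToC 21 (2025), §3.3, Def. 6.1. [DawarWilsenach2025]
-/

noncomputable section

open scoped Classical Pointwise

-- `Summit.ValiantsHypothesis.ValiantsHypothesis.…` is the tree's single-conjunct layout (Sub = Summit).
set_option linter.dupNamespace false

namespace Summit.ValiantsHypothesis.ValiantsHypothesis.Theorems

namespace KeyedParity

open Equiv Finset Literature.Computability.AlgebraicComplexity OrbitRestorationQPDepthThreeRung

variable {n : ℕ}

/-! ### Fibres of a label fixed by `σ` are permuted up to units, as multisets -/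

/-- The `σ`-translate of the fibre over `b` is the fibre over `σ • b` of the translated multiset. [folklore] -/
theorem filter_map_ren_eq_map_filter {β : Type} [DecidableEq β] [MulAction (Perm (Fin n)) β]
    (lab : MvPolynomial (Fin n × Fin n) ℂ → β)
    (B2 : ∀ (q : MvPolynomial (Fin n × Fin n) ℂ) (σ : Perm (Fin n)), lab (ren σ q) = σ • lab q)
    (L : Multiset (MvPolynomial (Fin n × Fin n) ℂ)) (σ : Perm (Fin n)) (b : β) :
    (L.map (ren σ)).filter (fun ℓ => lab ℓ = σ • b) = (L.filter fun ℓ => lab ℓ = b).map (ren σ) := by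
  rw [Multiset.filter_map]
  congr 1
  refine Multiset.filter_congr fun ℓ _ => ?_
  simp only [Function.comp_apply, B2]
  constructor
  · intro h; simpa using congrArg (fun x => σ⁻¹ • x) h
  · intro h; rw [h]

/-- **Fibres over a `σ`-fixed label value keep their associates under `σ`.**  For `f = a · Π L` nonzero,
diagonally invariant, with degree-one factors, a unit-invariant equivariant label `lab` and `σ • b = b`:
the multisets `σ · {ℓ ∈ L : lab ℓ = b}` and `{ℓ ∈ L : lab ℓ = b}` have the same associates. [folklore] -/
theorem map_mk_map_ren_filter_eq {β : Type} [DecidableEq β] [MulAction (Perm (Fin n)) β]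
    {L : Multiset (MvPolynomial (Fin n × Fin n) ℂ)} {a : ℂ} (lab : MvPolynomial (Fin n × Fin n) ℂ → β)
    (B1 : ∀ (q : MvPolynomial (Fin n × Fin n) ℂ) (u : ℂ), u ≠ 0 → lab (MvPolynomial.C u * q) = lab q)
    (B2 : ∀ (q : MvPolynomial (Fin n × Fin n) ℂ) (σ : Perm (Fin n)), lab (ren σ q) = σ • lab q)
    (hL1 : ∀ ℓ ∈ L, ℓ.totalDegree = 1) (hf0 : MvPolynomial.C a * L.prod ≠ 0)
    (hfix : ∀ σ : Perm (Fin n), ren σ (MvPolynomial.C a * L.prod) = MvPolynomial.C a * L.prod)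
    {σ : Perm (Fin n)} {b : β} (hb : σ • b = b) :
    ((L.filter fun ℓ => lab ℓ = b).map (ren σ)).map Associates.mk =
      (L.filter fun ℓ => lab ℓ = b).map Associates.mk := by
  have hP : ∀ p q : MvPolynomial (Fin n × Fin n) ℂ, Associated p q → (lab p = σ • b ↔ lab q = σ • b) := by
    intro p q hpq
    obtain ⟨c, hc0, rfl⟩ := SupportBlocks.exists_C_of_associated hpq
    rw [B1 p c hc0]
  have h1 := SupportBlocks.map_mk_filter_eq hP (SupportBlocks.map_mk_map_ren_eq hL1 hf0 hfix σ)
  rw [filter_map_ren_eq_map_filter lab B2 L σ b, hb] at h1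
  exact h1

/-- **An involution fixing the label value fixes the fibre product iff it negates an even number of fibre
members.** [folklore] -/
theorem ren_fibre_prod_eq_self_iff_even {β : Type} [DecidableEq β] [MulAction (Perm (Fin n)) β]
    {L : Multiset (MvPolynomial (Fin n × Fin n) ℂ)} {a : ℂ} (lab : MvPolynomial (Fin n × Fin n) ℂ → β)
    (B1 : ∀ (q : MvPolynomial (Fin n × Fin n) ℂ) (u : ℂ), u ≠ 0 → lab (MvPolynomial.C u * q) = lab q)
    (B2 : ∀ (q : MvPolynomial (Fin n × Fin n) ℂ) (σ : Perm (Fin n)), lab (ren σ q) = σ • lab q)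
    (hL1 : ∀ ℓ ∈ L, ℓ.totalDegree = 1) (hf0 : MvPolynomial.C a * L.prod ≠ 0)
    (hfix : ∀ σ : Perm (Fin n), ren σ (MvPolynomial.C a * L.prod) = MvPolynomial.C a * L.prod)
    {τ : Perm (Fin n)} (hτ : τ * τ = 1) {b : β} (hb : τ • b = b) :
    ren τ (L.filter fun ℓ => lab ℓ = b).prod = (L.filter fun ℓ => lab ℓ = b).prod ↔
      Even (Multiset.card ((L.filter fun ℓ => lab ℓ = b).filter fun ℓ => ren τ ℓ = -ℓ)) :=
  SignCount.ren_prod_eq_self_iff_even τ hτ _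
    (fun _ hℓ => AffineFactors.ne_zero_of_mem hf0 (Multiset.mem_of_mem_filter hℓ))
    (map_mk_map_ren_filter_eq lab B1 B2 hL1 hf0 hfix hb)

/-! ### The keyed-block theorem with counted parities -/

/-- **KEYED BLOCKS, PARITY FORM.**  Let `f = a · Π L ≠ 0` be a product of degree-one forms, invariant under the
diagonal action of `Sym(Fin n)`; let `supp` and `key` be unit-invariant equivariant assignments of finite sets
of indices with `key ℓ ⊆ supp ℓ`, `|supp ℓ| ≤ k`, the pointwise stabiliser of `supp ℓ` fixing `ℓ` (`ℓ ∈ L`).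
Suppose
(MID#) for all `K, T` and all `x, y ∈ T ∖ K`, the transposition `(x y)` negates an EVEN number of the factors
`ℓ ∈ L` with `key ℓ = K`, `supp ℓ = T`, and
(TOP#) for all `K` and all `x, y ∈ K`, `(x y)` negates an EVEN number of the factors `ℓ ∈ L` with
`key ℓ = K`.
Then `f` is `QPOrbitRestorable (k + 5)` at level `n`. [folklore; cite: DawarWilsenach2025, §3.3 and Def. 6.1] -/
theorem qpOrbitRestorable_of_keyedBlocks_parity {k : ℕ} (L : Multiset (MvPolynomial (Fin n × Fin n) ℂ)) (a : ℂ)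
    (supp key : MvPolynomial (Fin n × Fin n) ℂ → Finset (Fin n))
    (S1 : ∀ (q : MvPolynomial (Fin n × Fin n) ℂ) (u : ℂ), u ≠ 0 → supp (MvPolynomial.C u * q) = supp q)
    (S2 : ∀ (q : MvPolynomial (Fin n × Fin n) ℂ) (σ : Perm (Fin n)), supp (ren σ q) = σ • supp q)
    (K1 : ∀ (q : MvPolynomial (Fin n × Fin n) ℂ) (u : ℂ), u ≠ 0 → key (MvPolynomial.C u * q) = key q)
    (K2 : ∀ (q : MvPolynomial (Fin n × Fin n) ℂ) (σ : Perm (Fin n)), key (ren σ q) = σ • key q)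
    (S3 : ∀ ℓ ∈ L, ∀ τ : Perm (Fin n), (∀ x ∈ supp ℓ, τ x = x) → ren τ ℓ = ℓ)
    (S4 : ∀ ℓ ∈ L, (supp ℓ).card ≤ k) (K3 : ∀ ℓ ∈ L, key ℓ ⊆ supp ℓ)
    (hL1 : ∀ ℓ ∈ L, ℓ.totalDegree = 1) (hf0 : MvPolynomial.C a * L.prod ≠ 0)
    (hfix : ∀ σ : Perm (Fin n), ren σ (MvPolynomial.C a * L.prod) = MvPolynomial.C a * L.prod)
    (hMID : ∀ (K T : Finset (Fin n)), ∀ x ∈ T \ K, ∀ y ∈ T \ K,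
      Even (Multiset.card ((L.filter fun ℓ => key ℓ = K ∧ supp ℓ = T).filter
        fun ℓ => ren (swap x y) ℓ = -ℓ)))
    (hTOP : ∀ (K : Finset (Fin n)), ∀ x ∈ K, ∀ y ∈ K,
      Even (Multiset.card ((L.filter fun ℓ => key ℓ = K).filter fun ℓ => ren (swap x y) ℓ = -ℓ))) :
    QPOrbitRestorable (k + 5) n (MvPolynomial.C a * L.prod) := by
  -- the pair label `(key, supp)` and its fibres
  let lab : MvPolynomial (Fin n × Fin n) ℂ → Finset (Fin n) × Finset (Fin n) := fun q => (key q, supp q)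
  have hLab1 : ∀ (q : MvPolynomial (Fin n × Fin n) ℂ) (u : ℂ), u ≠ 0 → lab (MvPolynomial.C u * q) = lab q :=
    fun q u hu => by simp [lab, S1 q u hu, K1 q u hu]
  have hLab2 : ∀ (q : MvPolynomial (Fin n × Fin n) ℂ) (σ : Perm (Fin n)), lab (ren σ q) = σ • lab q :=
    fun q σ => by simp [lab, S2, K2]
  have hsub_lab : ∀ K T : Finset (Fin n),
      (L.filter fun ℓ => key ℓ = K ∧ supp ℓ = T) = L.filter fun ℓ => lab ℓ = (K, T) := fun K T =>
    Multiset.filter_congr fun ℓ _ => by simp [lab, Prod.ext_iff]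
  refine KeyedBlocks.qpOrbitRestorable_of_keyedBlocks L a supp key S1 S2 K1 K2 S3 S4 K3 hL1 hf0 hfix ?_ ?_
  · -- (MID) from (MID#)
    intro K T x hx y hy
    have hxT : x ∈ T := (Finset.mem_sdiff.1 hx).1
    have hyT : y ∈ T := (Finset.mem_sdiff.1 hy).1
    have hK : swap x y • K = K :=
      KeyedBlocks.smul_eq_of_fix fun z hz => swap_apply_of_ne_of_ne
        (fun h => (Finset.mem_sdiff.1 hx).2 (h ▸ hz)) (fun h => (Finset.mem_sdiff.1 hy).2 (h ▸ hz))
    have hb : swap x y • ((K, T) : Finset (Fin n) × Finset (Fin n)) = (K, T) := by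
      rw [Prod.smul_mk, hK, SignFree.swap_smul_finset_eq hxT hyT]
    rw [hsub_lab]
    refine (ren_fibre_prod_eq_self_iff_even lab hLab1 hLab2 hL1 hf0 hfix (swap_mul_self x y) hb).2 ?_
    rw [← hsub_lab]
    exact hMID K T x hx y hy
  · -- (TOP) from (TOP#)
    intro K x hx y hy
    exact (ren_fibre_prod_eq_self_iff_even key K1 K2 hL1 hf0 hfix (swap_mul_self x y)
      (SignFree.swap_smul_finset_eq hx hy)).2 (hTOP K x hx y hy)

end KeyedParity

end Summit.ValiantsHypothesis.ValiantsHypothesis.Theorems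

end
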